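import Summits.HubbardSuperconductivity.HubbardSuperconductivity.Theorems.AnisotropyChordTransferFibre3Hole2BondGap
import Summits.HubbardSuperconductivity.HubbardSuperconductivity.Theorems.AnisotropyChordTransferFibre3WindowRate
import Summits.HubbardSuperconductivity.HubbardSuperconductivity.Theorems.AnisotropyChordTransferFibre3DiagonalValues
import Summits.HubbardSuperconductivity.HubbardSuperconductivity.Theorems.AnisotropyChordTransferFibre3LamPart
import Summits.HubbardSuperconductivity.HubbardSuperconductivity.Theorems.AnisotropyChordTransferFibre3ShellMajorant

/-!
# Route `AnisotropyChord` / H0 rotor rung: HOLE₂(.75) FOR EVERY `L ≥ 64` — the analytic regime of the theorem of channels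

★ `twoHoleGap_threeQuarter_of_ge_64`: `64 ≤ L ⇒ TwoHoleGap L (3/4·eps1 L)`.

The theorem of channels (`…Fibre3Hole2BondGap.twoHoleGap_of_channels_int`) reduces HOLE₂(.75) at `L` to
`aKer L λ_H (2,0) ≤ ½` and `2·aKer L λ_H (1,1) − aKer L λ_H (2,0) ≤ ½` at `λ_H = (3/2)ε₁`.  Every ∀L input is already a tree
theorem: the `λ = 0` window rates `|a_L(2,0;0) − (1 − 2/π)| ≤ 4/L²`, `|a_L(1,1;0) − 1/π| ≤ 1/L²` (`L ≥ 12`; p1 g25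
`…WindowRate.dev_two_zero/dev_one_one`, `…DiagonalValues.aZ2_two_zero'/aZ2_one_one`), and the λ-half of the RATE lemma
`0 ≤ a_L(r;λ_H) − a_L(r;0) ≤ S(r,L;λ_H) ≤ |r|²(11.71 ln L + 5.9)/L²` (p2 `…LamPart.lamPartShellBound_holds`,
`…ShellMajorant.shellMajorant_holds`).  With `ln L ≤ 6 ln 2 + L/64 − 1` (`L ≥ 64`) the error per unit `|r|²` is `≤ .0134`, so
`aKer(2,0) ≤ .3634 + .001 + .0536 < ½` and `2aKer(1,1) − aKer(2,0) ≤ (4/π − 1) + 6/L² + .0536 < ½`.  (The same inputs give the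
two inequalities from `L = 39` on with sharper numerics; `37 ≤ L ≤ 63` is covered by the three-value channel check
`…Fibre3Hole2Chan` instead, and `9 ≤ L ≤ 36` by g3's kernel certificates.)
Prover seat `hubbard-h0-rotor-p3` g4; helper for stmt-HubbardSuperconductivity-19089 (`--supports`, helper class).
WHAT THIS IS NOT: nothing here proves superconductivity in the Hubbard model (rotor TARGET as worded stays FALSE, g15 verdict);
it discharges ONE hypothesis (HOLE₂) of ONE conditional reduction (rung 19089) for `L ≥ 64`. Tree imports only; no sorry.
-/

set_option linter.dupNamespace false
set_option autoImplicit false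

noncomputable section

namespace Summit.HubbardSuperconductivity.HubbardSuperconductivity.Theorems.AnisotropyChord.Transfer.Fibre3

namespace Hole2

variable (L : ℕ) [NeZero L]

omit [NeZero L] in
/-- `ln L ≤ 3.16 + L/64` for `L ≥ 64` (`ln L = 6 ln 2 + ln(L/64)`, `ln x ≤ x − 1`, `ln 2 < .6931471808`). [folklore] -/
theorem log_le_of_ge_64 (hL : 64 ≤ L) : Real.log L ≤ 3.16 + (L : ℝ) / 64 := by
  have hLpos : (0 : ℝ) < L := by exact_mod_cast (show 0 < L by omega)
  have h64 : (L : ℝ) = 64 * ((L : ℝ) / 64) := by ring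
  have hq : (0 : ℝ) < (L : ℝ) / 64 := by positivity
  rw [h64, Real.log_mul (by norm_num) hq.ne']
  have h2 : Real.log 64 = 6 * Real.log 2 := by
    rw [show (64 : ℝ) = 2 ^ 6 by norm_num, Real.log_pow]; norm_num
  have hl2 := Real.log_two_lt_d9
  have hsub := Real.log_le_sub_one_of_pos hq
  rw [h2]
  have : 64 * ((L : ℝ) / 64) / 64 = (L : ℝ) / 64 := by ring
  rw [this]
  linarith

omit [NeZero L] in
/-- the shell-majorant error per unit `|r|²` at `L ≥ 64`: `(11.71 ln L + 5.9)/L² ≤ .0134`. [folklore] -/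
theorem shellErr_le (hL : 64 ≤ L) : (11.71 * Real.log L + 5.9) / (L : ℝ) ^ 2 ≤ 0.0134 := by
  have hL' : (64 : ℝ) ≤ L := by exact_mod_cast hL
  have hLpos : (0 : ℝ) < L := by linarith
  have hlog := log_le_of_ge_64 L hL
  rw [div_le_iff₀ (by positivity)]
  nlinarith [mul_nonneg (sub_nonneg.mpr hL') hLpos.le]

/-- ★★★ HOLE₂(.75) FOR EVERY `L ≥ 64`: `TwoHoleGap L (3/4·ε₁)` by the theorem of channels with the tree's ∀L window rates. [folklore] -/
theorem twoHoleGap_threeQuarter_of_ge_64 (hL : 64 ≤ L) : TwoHoleGap L (3 / 4 * eps1 L) := by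
  have hL2 : 2 ≤ L := by omega
  have hε := RateLemma.eps1_pos_of_two_le L hL2
  have hg0 : 0 < 3 / 4 * eps1 L := by positivity
  have hg : 3 / 4 * eps1 L < eps1 L := by linarith
  have hlam : 2 * (3 / 4 * eps1 L) = 3 / 2 * eps1 L := by ring
  have hL' : (64 : ℝ) ≤ L := by exact_mod_cast hL
  have hLpos : (0 : ℝ) < L := by linarith
  have hV : (0 : ℝ) < (L : ℝ) ^ 2 := by positivity
  -- the λ-half of the RATE lemma at the two points
  have hSB := RateLemma.lamPartShellBound_holds L (by omega) (3 / 2 * eps1 L) (by positivity) (by linarith)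
  have hSM := RateLemma.shellMajorant_holds L (by omega) (3 / 2 * eps1 L) (by positivity) le_rfl
  obtain ⟨h20lo, h20hi⟩ := hSB ((((2 : ℤ)) : ZMod L), (((0 : ℤ)) : ZMod L))
  obtain ⟨h11lo, h11hi⟩ := hSB ((((1 : ℤ)) : ZMod L), (((1 : ℤ)) : ZMod L))
  have hM20 := hSM 2 0
  have hM11 := hSM 1 1
  unfold RateLemma.lamPart at h20lo h20hi h11lo h11hi
  have hE := shellErr_le L hL
  have hM20' : RateLemma.shellSum L (3 / 2 * eps1 L) ((((2 : ℤ)) : ZMod L), (((0 : ℤ)) : ZMod L)) ≤ 4 * 0.0134 := by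
    have : (((2 : ℤ) : ℝ) ^ 2 + ((0 : ℤ) : ℝ) ^ 2) * (11.71 * Real.log L + 5.9) / (L : ℝ) ^ 2
        = 4 * ((11.71 * Real.log L + 5.9) / (L : ℝ) ^ 2) := by push_cast; ring
    rw [this] at hM20
    linarith
  have hM11' : RateLemma.shellSum L (3 / 2 * eps1 L) ((((1 : ℤ)) : ZMod L), (((1 : ℤ)) : ZMod L)) ≤ 2 * 0.0134 := by
    have : (((1 : ℤ) : ℝ) ^ 2 + ((1 : ℤ) : ℝ) ^ 2) * (11.71 * Real.log L + 5.9) / (L : ℝ) ^ 2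
        = 2 * ((11.71 * Real.log L + 5.9) / (L : ℝ) ^ 2) := by push_cast; ring
    rw [this] at hM11
    linarith
  -- the λ = 0 window values
  have hD20 := Subsample.dev_two_zero L (by omega)
  have hD11 := Subsample.dev_one_one L (by omega)
  rw [Subsample.aZ2_two_zero'] at hD20
  rw [Subsample.aZ2_one_one] at hD11
  obtain ⟨hD20l, hD20u⟩ := abs_le.mp hD20
  obtain ⟨hD11l, hD11u⟩ := abs_le.mp hD11
  have hinv : 4 / (L : ℝ) ^ 2 ≤ 0.001 := by
    rw [div_le_iff₀ hV]; nlinarith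
  have hinv1 : 1 / (L : ℝ) ^ 2 ≤ 0.00025 := by
    rw [div_le_iff₀ hV]; nlinarith
  -- π numerics: `2/π ≥ .6366`, `4/π ≤ 1.2733`
  have hπ := Real.pi_pos
  have h2pi : 0.6366 ≤ 2 / Real.pi := by
    rw [le_div_iff₀ hπ]; nlinarith [Real.pi_lt_d6]
  have h4pi : 4 / Real.pi ≤ 1.2733 := by
    rw [div_le_iff₀ hπ]; nlinarith [Real.pi_gt_d6]
  have hpiC2 : 2 * (1 / Real.pi) + 2 / Real.pi ≤ 1.2733 := by
    rw [show 2 * (1 / Real.pi) + 2 / Real.pi = 4 / Real.pi by ring]; exact h4pi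
  refine TwoHoleBS.twoHoleGap_of_channels_int L hL2 hg0 hg ?_ ?_
  · rw [hlam]; linarith
  · rw [hlam]; linarith

end Hole2

end Summit.HubbardSuperconductivity.HubbardSuperconductivity.Theorems.AnisotropyChord.Transfer.Fibre3

end
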